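import Summits.HodgeConjecture.CorCM.IrreducibleOddWeightsMultiplicityFamilies
import Literature.AlgebraicGeometry.Pohlmann1968.SeparatingCMFamilies
import HarnessLib

/-!
# The additivity DEFECT of the rank of a family of CM types across a split of its members is a multiplicity count of
# INTERSECTIONS of evaluation spaces: `dim Hg(∏_I) = dim Hg(∏_T) + dim Hg(∏_{Tᶜ}) − Σ_π (d_π/δ_π) dim(Ev_T(π) ∩ Ev_{Tᶜ}(π))`

COR-CM (cell `pub-hodgecm2`, binder seat `b16` gen 57, count-neutral claim MULTIPLICITY, file F7 — sequel of F4
`CorCM/IrreducibleOddWeightsMultiplicityFamilies`; theorems only, no definition, no named fact, no `sorry`).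
NEW as stated, hence under `Summits/`.  HONEST FRAMING: the rank of a family of CM types (`dim MT` of a product of CM
abelian varieties) "for NAMED configurations" (kernel, unconditional) for INT-4 «what is known»; no hypothesis on the
slots beyond a covering family of irreducible representations for each member; `HC_CM` is neither used nor asserted.

SETTING (local notation, no definition): `Ev[G, π, w] = {T w : T : ℚ^X → V equivariant}`, the slot evaluation spaces
`Ev_i(π) = Ev[G, π, u_1(Φ_i)]`, and for a set of slots `p` the block evaluation space `Ev_p(π) = Σ_{j : p j} Ev_j(π) ≤ V`
(= the evaluation space of the sub-family `Σ|_p`, F4 `evalSpace_antiVec_sigmaType_eq_iSup`).  The tree decides block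
additivity `U(Σ) = U(Σ|_p) ⊕ U(Σ|_{¬p})` QUALITATIVELY (`Literature/…/CMTypeRankPartition`: no common constituent
between the blocks).  Here the DEFECT is computed:

> **Theorem** (`finrank_antiSpan_sigmaType_add_sum_eq`).  For pairwise non-isomorphic irreducible `(π_k, V_k)`
> covering every member `U(Φ_i)`, and any split `p` of the slots,
> `dim U(Σ) + Σ_k d_k · (dim (Ev_p(π_k) ∩ Ev_{¬p}(π_k)) / δ_k) = dim U(Σ|_p) + dim U(Σ|_{¬p})`,
> with `δ_k ∣ dim (Ev_p(π_k) ∩ Ev_{¬p}(π_k))`.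

(Grassmann's formula in each `V_k` for `Ev_I = Ev_p + Ev_{¬p}`, weighted by `d_k/δ_k` through F4.)  On Hodge groups:
`dim Hg(∏_I A_i) = dim Hg(∏_p A_i) + dim Hg(∏_{¬p} A_i) − Σ_π (d_π/δ_π) dim(Ev_p(π) ∩ Ev_{¬p}(π))` — the dimensions lost
in a product are accounted for, irreducible by irreducible, by the INTERSECTIONS of the block evaluation spaces.
* `finrank_antiSpan_sigmaType_eq_add_iff`: block additivity ⟺ `Ev_p(π_k) ∩ Ev_{¬p}(π_k) = 0` for every `k`;
* `finrank_antiSpan_sigmaType_le_card_div_two` (bookkeeping `dim U(Σ) ≤ |⊔E_i|/2` for CM types, empty family allowed);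
* CM fields (`Aut(ℂ)` on `⊔_i Hom(K_i, ℂ)`, `T : Finset I`): **`cmFamilyRank_add_sum_eq`** (`rank(Φ) + 1 + Σ_k d_k ·
  (dim(Ev_T ∩ Ev_{Tᶜ})/δ_k) = rank(Φ|_T) + rank(Φ|_{Tᶜ})`), **`not_isNondegenerateFamily_of_inf_ne_bot`** (ONE non-zero
  intersection `Ev_T(π) ∩ Ev_{Tᶜ}(π) ≠ 0` makes the family DEGENERATE) and **`exists_exceptional_prod_of_inf_ne_bot`**
  (simple, pairwise non-isogenous realisations then carry an EXCEPTIONAL Hodge class on some product).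

## References

* [Mai1989] L. Mai, *Lower bounds for the ranks of CM types*, J. Number Theory 32 (1989), §2 Prop. 1 (proof).
* [Gordon1999HodgeAVSurvey] B. B. Gordon, *A survey of the Hodge conjecture for abelian varieties*, §3, 7.5–7.7, 9.4.4.
* [MoonenZarhin1999LowDim] B. Moonen, Yu. Zarhin, *Hodge classes on abelian varieties of low dimension*, Math. Ann.
  315 (1999), §3 (3.1).
* [Deligne1982HodgeCycles] P. Deligne, *Hodge cycles on abelian varieties*, LNM 900 (1982), I Ex. 3.7 (c).
-/

set_option autoImplicit false

noncomputable section

open scoped BigOperators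

open NumberField

universe u u' v w

namespace Summit.HodgeConjecture.CorCM.IrrOdd

open Literature.NumberTheory.ComplexMultiplication

variable {G : Type w} [Group G]

/-- The evaluation space `Ev[G, π, w] = {T w : T equivariant}` (local notation, no definition). -/
local notation3 (prettyPrint := false) "Ev[" G' ", " π ", " w "]" =>
  Submodule.span ℚ {v | ∃ T : (_ → ℚ) →ₗ[ℚ] _,
    (∀ (g : G') (f : _ → ℚ), T (fun x => f (g⁻¹ • x)) = π g (T f)) ∧ T w = v}

variable {I : Type u} {E : I → Type v} [∀ i, MulAction G (E i)] [Fintype I] [∀ i, Fintype (E i)]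

/-! ### §1 Bookkeeping -/

/-- **`dim U(Σ) ≤ |⊔_i E_i| / 2`** for a family of CM types (the empty family included: then both sides vanish).
[cite: Gordon1999HodgeAVSurvey, 7.7] [cite: Shimura1998, §32.10] -/
theorem finrank_antiSpan_sigmaType_le_card_div_two {ρ : G} {Φ : ∀ i, Set (E i)} (h : ∀ i, IsCMTypeWith ρ (Φ i)) :
    Module.finrank ℚ (antiSpan G (sigmaType Φ)) ≤ Fintype.card (Σ i, E i) / 2 := by
  rcases isEmpty_or_nonempty (Σ i, E i) with hE | hE
  · have h0 := Submodule.finrank_le (antiSpan G (sigmaType Φ))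
    rw [Module.finrank_fintype_fun_eq_card, Fintype.card_eq_zero, Nat.le_zero] at h0
    rw [h0]
    exact Nat.zero_le _
  · have h1 := (IsCMTypeWith.sigmaType h).typeRank_le
    rw [(IsCMTypeWith.sigmaType h).typeRank_eq_finrank_antiSpan_add_one] at h1
    omega

/-! ### §2 The defect across a split of the slots -/

section Defect

variable {K : Type u'} [Fintype K] {V : K → Type*} [∀ k, AddCommGroup (V k)] [∀ k, Module ℚ (V k)]
  [∀ k, FiniteDimensional ℚ (V k)]

omit [Fintype I] [∀ i, Fintype (E i)] in
/-- The family evaluation space splits along `p`: `Σ_i Ev_i = Ev_p + Ev_{¬p}`. [folklore] -/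
theorem iSup_evalSpace_eq_sup {W : Type*} [AddCommGroup W] [Module ℚ W] (π : Representation ℚ G W)
    (Φ : ∀ i, Set (E i)) (p : I → Prop) :
    (⨆ i, Ev[G, π, antiVec (Φ i) (1 : G)] : Submodule ℚ W) =
      (⨆ j : {j // p j}, Ev[G, π, antiVec (Φ j.1) (1 : G)]) ⊔ ⨆ j : {j // ¬ p j}, Ev[G, π, antiVec (Φ j.1) (1 : G)] := by
  rw [iSup_split _ p, iSup_subtype, iSup_subtype]

/-- **THE DEFECT FORMULA.**  For pairwise non-isomorphic irreducible `(π_k, V_k)` covering every member `U(Φ_i)` and any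
split `p` of the slots:  `δ_k ∣ dim(Ev_p(π_k) ∩ Ev_{¬p}(π_k))` and
**`dim U(Σ) + Σ_k d_k · (dim(Ev_p(π_k) ∩ Ev_{¬p}(π_k)) / δ_k) = dim U(Σ|_p) + dim U(Σ|_{¬p})`** — on Hodge groups
`dim Hg(∏_p A_i) + dim Hg(∏_{¬p} A_i) − dim Hg(∏_I A_i) = Σ_π (d_π/δ_π) · dim(Ev_p(π) ∩ Ev_{¬p}(π))`.
[cite: Mai1989, §2 Prop. 1 (proof)] [cite: Gordon1999HodgeAVSurvey, §3 Theorem (proof) and 7.5–7.7] -/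
theorem finrank_antiSpan_sigmaType_add_sum_eq (Φ : ∀ i, Set (E i)) (π : ∀ k, Representation ℚ G (V k))
    (hirr : ∀ k, (π k).IsIrreducible) (hne : ∀ k l, k ≠ l → ∀ S : (π k).IntertwiningMap (π l), S = 0)
    (hcov : ∀ (i : I) (P : Submodule ℚ (E i → ℚ)), P ≤ antiSpan G (Φ i) → P ≠ ⊥ →
      (∀ (g : G) (a : E i → ℚ), a ∈ P → (fun s => a (g • s)) ∈ P) →
      ∃ k, ∃ T : (E i → ℚ) →ₗ[ℚ] V k,
        (∀ (g : G) (a : E i → ℚ), T (fun s => a (g⁻¹ • s)) = π k g (T a)) ∧ ∃ a ∈ P, T a ≠ 0)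
    (p : I → Prop) [DecidablePred p] :
    (∀ k, Module.finrank ℚ ((π k).IntertwiningMap (π k)) ∣
      Module.finrank ℚ ((⨆ j : {j // p j}, Ev[G, π k, antiVec (Φ j.1) (1 : G)]) ⊓
        ⨆ j : {j // ¬ p j}, Ev[G, π k, antiVec (Φ j.1) (1 : G)] : Submodule ℚ (V k))) ∧
    Module.finrank ℚ (antiSpan G (sigmaType Φ)) + ∑ k, Module.finrank ℚ (V k) *
        (Module.finrank ℚ ((⨆ j : {j // p j}, Ev[G, π k, antiVec (Φ j.1) (1 : G)]) ⊓
            ⨆ j : {j // ¬ p j}, Ev[G, π k, antiVec (Φ j.1) (1 : G)] : Submodule ℚ (V k)) /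
          Module.finrank ℚ ((π k).IntertwiningMap (π k))) =
      Module.finrank ℚ (antiSpan G (sigmaType fun j : {j // p j} => Φ j.1)) +
        Module.finrank ℚ (antiSpan G (sigmaType fun j : {j // ¬ p j} => Φ j.1)) := by
  classical
  -- the three multiplicity formulas
  obtain ⟨hdI, hI⟩ := finrank_antiSpan_sigmaType_eq_sum Φ π hirr hne (cover_sigmaType_of_forall Φ π hcov)
  obtain ⟨hdp, hp⟩ := finrank_antiSpan_sigmaType_eq_sum (fun j : {j // p j} => Φ j.1) π hirr hne
    (cover_sigmaType_of_forall (E := fun j : {j // p j} => E j.1) _ π fun j => hcov j.1)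
  obtain ⟨hdn, hn⟩ := finrank_antiSpan_sigmaType_eq_sum (fun j : {j // ¬ p j} => Φ j.1) π hirr hne
    (cover_sigmaType_of_forall (E := fun j : {j // ¬ p j} => E j.1) _ π fun j => hcov j.1)
  -- Grassmann in each `V_k`
  have hG : ∀ k, Module.finrank ℚ (⨆ i, Ev[G, π k, antiVec (Φ i) (1 : G)] : Submodule ℚ (V k)) +
      Module.finrank ℚ ((⨆ j : {j // p j}, Ev[G, π k, antiVec (Φ j.1) (1 : G)]) ⊓
        ⨆ j : {j // ¬ p j}, Ev[G, π k, antiVec (Φ j.1) (1 : G)] : Submodule ℚ (V k)) =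
      Module.finrank ℚ (⨆ j : {j // p j}, Ev[G, π k, antiVec (Φ j.1) (1 : G)] : Submodule ℚ (V k)) +
        Module.finrank ℚ (⨆ j : {j // ¬ p j}, Ev[G, π k, antiVec (Φ j.1) (1 : G)] : Submodule ℚ (V k)) := by
    intro k
    rw [iSup_evalSpace_eq_sup (π k) Φ p]
    exact Submodule.finrank_sup_add_finrank_inf_eq _ _
  have hdvd : ∀ k, Module.finrank ℚ ((π k).IntertwiningMap (π k)) ∣
      Module.finrank ℚ ((⨆ j : {j // p j}, Ev[G, π k, antiVec (Φ j.1) (1 : G)]) ⊓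
        ⨆ j : {j // ¬ p j}, Ev[G, π k, antiVec (Φ j.1) (1 : G)] : Submodule ℚ (V k)) := fun k => by
    have h := hG k
    have h' := (Nat.dvd_add_right (hdI k)).1 (h.symm ▸ dvd_add (hdp k) (hdn k) :
      Module.finrank ℚ ((π k).IntertwiningMap (π k)) ∣ _ + _)
    exact h'
  refine ⟨hdvd, ?_⟩
  rw [hI, hp, hn, ← Finset.sum_add_distrib, ← Finset.sum_add_distrib]
  refine Finset.sum_congr rfl fun k _ => ?_
  rw [← mul_add, ← mul_add, ← Nat.add_div_of_dvd_right (hdI k), ← Nat.add_div_of_dvd_right (hdp k), hG k]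

/-- **Block additivity ⟺ trivial intersections**: `dim U(Σ) = dim U(Σ|_p) + dim U(Σ|_{¬p})` — on Hodge groups
`Hg(∏_I A_i) = Hg(∏_p A_i) × Hg(∏_{¬p} A_i)` — iff `Ev_p(π_k) ∩ Ev_{¬p}(π_k) = 0` for every `k` (the quantitative
form of the tree's "no common constituent between the blocks"). [cite: Gordon1999HodgeAVSurvey, §3 Theorem (proof)]
[cite: Mai1989, §2 Prop. 1 (proof)] -/
theorem finrank_antiSpan_sigmaType_eq_add_iff (Φ : ∀ i, Set (E i)) (π : ∀ k, Representation ℚ G (V k))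
    (hirr : ∀ k, (π k).IsIrreducible) (hne : ∀ k l, k ≠ l → ∀ S : (π k).IntertwiningMap (π l), S = 0)
    (hcov : ∀ (i : I) (P : Submodule ℚ (E i → ℚ)), P ≤ antiSpan G (Φ i) → P ≠ ⊥ →
      (∀ (g : G) (a : E i → ℚ), a ∈ P → (fun s => a (g • s)) ∈ P) →
      ∃ k, ∃ T : (E i → ℚ) →ₗ[ℚ] V k,
        (∀ (g : G) (a : E i → ℚ), T (fun s => a (g⁻¹ • s)) = π k g (T a)) ∧ ∃ a ∈ P, T a ≠ 0)
    (p : I → Prop) [DecidablePred p] :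
    Module.finrank ℚ (antiSpan G (sigmaType Φ)) =
        Module.finrank ℚ (antiSpan G (sigmaType fun j : {j // p j} => Φ j.1)) +
          Module.finrank ℚ (antiSpan G (sigmaType fun j : {j // ¬ p j} => Φ j.1)) ↔
      ∀ k, ((⨆ j : {j // p j}, Ev[G, π k, antiVec (Φ j.1) (1 : G)]) ⊓
        ⨆ j : {j // ¬ p j}, Ev[G, π k, antiVec (Φ j.1) (1 : G)] : Submodule ℚ (V k)) = ⊥ := by
  obtain ⟨hdvd, hsum⟩ := finrank_antiSpan_sigmaType_add_sum_eq Φ π hirr hne hcov p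
  constructor
  · intro h k
    have h0 : ∑ k, Module.finrank ℚ (V k) *
        (Module.finrank ℚ ((⨆ j : {j // p j}, Ev[G, π k, antiVec (Φ j.1) (1 : G)]) ⊓
            ⨆ j : {j // ¬ p j}, Ev[G, π k, antiVec (Φ j.1) (1 : G)] : Submodule ℚ (V k)) /
          Module.finrank ℚ ((π k).IntertwiningMap (π k))) = 0 := by omega
    have hk := (Finset.sum_eq_zero_iff.1 h0) k (Finset.mem_univ k)
    rcases Nat.mul_eq_zero.1 hk with hd | hq
    · exact absurd hd (finrank_pos_of_isIrreducible (π k) (hirr k)).ne'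
    · rw [← Submodule.finrank_eq_zero]
      exact Nat.eq_zero_of_dvd_of_lt (hdvd k)
        ((Nat.div_eq_zero_iff_lt (finrank_intertwiningMap_pos (π k) (hirr k))).1 hq)
  · intro h
    have h0 : ∑ k, Module.finrank ℚ (V k) *
        (Module.finrank ℚ ((⨆ j : {j // p j}, Ev[G, π k, antiVec (Φ j.1) (1 : G)]) ⊓
            ⨆ j : {j // ¬ p j}, Ev[G, π k, antiVec (Φ j.1) (1 : G)] : Submodule ℚ (V k)) /
          Module.finrank ℚ ((π k).IntertwiningMap (π k))) = 0 :=
      Finset.sum_eq_zero fun k _ => by rw [h k, finrank_bot, Nat.zero_div, mul_zero]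
    omega

end Defect

end Summit.HodgeConjecture.CorCM.IrrOdd

/-! ### §3 CM fields: degenerate families and exceptional classes from one non-zero intersection -/

namespace Summit.HodgeConjecture.CorCM

open CategoryTheory CategoryTheory.Limits
open Literature.NumberTheory.ComplexMultiplication
open Literature.AlgebraicGeometry.Motives (AbelianVariety CMType)
open Literature.AlgebraicGeometry.HodgeTheory
open Literature.AlgebraicGeometry.ComplexMultiplication (IsCMTypeRealisation)
open Literature.AlgebraicGeometry.Pohlmann1968
open Literature.Barriers.HodgeConjecture (divisorClassesSpan)

/-- The evaluation space `Ev[G, π, w] = {T w : T equivariant}` (local notation, no definition). -/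
local notation3 (prettyPrint := false) "Ev[" G' ", " π ", " w "]" =>
  Submodule.span ℚ {v | ∃ T : (_ → ℚ) →ₗ[ℚ] _,
    (∀ (g : G') (f : _ → ℚ), T (fun x => f (g⁻¹ • x)) = π g (T f)) ∧ T w = v}

variable {I : Type} [Fintype I] {K : I → Type} [∀ i, Field (K i)] [∀ i, NumberField (K i)] [∀ i, IsCMField (K i)]
  {κ : Type u'} [Fintype κ] {V : κ → Type*} [∀ k, AddCommGroup (V k)] [∀ k, Module ℚ (V k)]
  [∀ k, FiniteDimensional ℚ (V k)]

/-- **CM fields, the defect across `T ⊔ Tᶜ`**: `rank(Φ) + 1 + Σ_k d_k · (dim(Ev_T(π_k) ∩ Ev_{Tᶜ}(π_k)) / δ_k) =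
rank(Φ|_T) + rank(Φ|_{Tᶜ})`, i.e. `dim MT(∏_I A_i) = dim MT(∏_T A_i) + dim MT(∏_{Tᶜ} A_i) − 1 − Σ_π (d_π/δ_π) ·
dim(Ev_T(π) ∩ Ev_{Tᶜ}(π))` (`T`, `Tᶜ` non-empty; irreducibles covering every member).
[cite: Mai1989, §2 Prop. 1 (proof)] [cite: Gordon1999HodgeAVSurvey, 7.5–7.7] -/
theorem cmFamilyRank_add_sum_eq (Φ : ∀ i, CMType (K i)) (π : ∀ k, Representation ℚ (ℂ ≃+* ℂ) (V k))
    (hirr : ∀ k, (π k).IsIrreducible) (hne : ∀ k l, k ≠ l → ∀ S : (π k).IntertwiningMap (π l), S = 0)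
    (hcov : ∀ (i : I) (P : Submodule ℚ ((K i →+* ℂ) → ℚ)), P ≤ antiSpan (ℂ ≃+* ℂ) (Φ i).1 → P ≠ ⊥ →
      (∀ (g : ℂ ≃+* ℂ) (a : (K i →+* ℂ) → ℚ), a ∈ P → (fun s => a (g • s)) ∈ P) →
      ∃ k, ∃ T : ((K i →+* ℂ) → ℚ) →ₗ[ℚ] V k,
        (∀ (g : ℂ ≃+* ℂ) (a : (K i →+* ℂ) → ℚ), T (fun s => a (g⁻¹ • s)) = π k g (T a)) ∧ ∃ a ∈ P, T a ≠ 0)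
    (T : Finset I) (hT : T.Nonempty) (hT' : ∃ i, i ∉ T) :
    CMAlgebra.cmFamilyRank Φ + 1 + ∑ k, Module.finrank ℚ (V k) *
        (Module.finrank ℚ ((⨆ j : {j // j ∈ T}, Ev[ℂ ≃+* ℂ, π k, antiVec (Φ j.1).1 (1 : ℂ ≃+* ℂ)]) ⊓
            ⨆ j : {j // j ∉ T}, Ev[ℂ ≃+* ℂ, π k, antiVec (Φ j.1).1 (1 : ℂ ≃+* ℂ)] : Submodule ℚ (V k)) /
          Module.finrank ℚ ((π k).IntertwiningMap (π k))) =
      CMAlgebra.cmFamilyRank (fun j : {j // j ∈ T} => Φ j.1) +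
        CMAlgebra.cmFamilyRank (fun j : {j // j ∉ T} => Φ j.1) := by
  classical
  obtain ⟨i₀, hi₀⟩ := hT
  obtain ⟨i₁, hi₁⟩ := hT'
  obtain ⟨s₀⟩ : Nonempty (K i₀ →+* ℂ) := inferInstance
  obtain ⟨s₁⟩ : Nonempty (K i₁ →+* ℂ) := inferInstance
  haveI : Nonempty (Σ i, (K i →+* ℂ)) := ⟨⟨i₀, s₀⟩⟩
  haveI : Nonempty (Σ j : {j // j ∈ T}, (K j.1 →+* ℂ)) := ⟨⟨⟨i₀, hi₀⟩, s₀⟩⟩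
  haveI : Nonempty (Σ j : {j // j ∉ T}, (K j.1 →+* ℂ)) := ⟨⟨⟨i₁, hi₁⟩, s₁⟩⟩
  have e0 : CMAlgebra.cmFamilyRank Φ =
      Module.finrank ℚ (antiSpan (ℂ ≃+* ℂ) (sigmaType fun i => (Φ i).1)) + 1 :=
    (IsCMTypeWith.sigmaType fun i => isCMTypeWith_conj (Φ i)).typeRank_eq_finrank_antiSpan_add_one
  have e1 : CMAlgebra.cmFamilyRank (fun j : {j // j ∈ T} => Φ j.1) =
      Module.finrank ℚ (antiSpan (ℂ ≃+* ℂ) (sigmaType fun j : {j // j ∈ T} => (Φ j.1).1)) + 1 :=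
    (IsCMTypeWith.sigmaType (E := fun j : {j // j ∈ T} => K j.1 →+* ℂ)
      fun j => isCMTypeWith_conj (Φ j.1)).typeRank_eq_finrank_antiSpan_add_one
  have e2 : CMAlgebra.cmFamilyRank (fun j : {j // j ∉ T} => Φ j.1) =
      Module.finrank ℚ (antiSpan (ℂ ≃+* ℂ) (sigmaType fun j : {j // j ∉ T} => (Φ j.1).1)) + 1 :=
    (IsCMTypeWith.sigmaType (E := fun j : {j // j ∉ T} => K j.1 →+* ℂ)
      fun j => isCMTypeWith_conj (Φ j.1)).typeRank_eq_finrank_antiSpan_add_one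
  have h : Module.finrank ℚ (antiSpan (ℂ ≃+* ℂ) (sigmaType fun i => (Φ i).1)) + ∑ k, Module.finrank ℚ (V k) *
        (Module.finrank ℚ ((⨆ j : {j // j ∈ T}, Ev[ℂ ≃+* ℂ, π k, antiVec (Φ j.1).1 (1 : ℂ ≃+* ℂ)]) ⊓
            ⨆ j : {j // j ∉ T}, Ev[ℂ ≃+* ℂ, π k, antiVec (Φ j.1).1 (1 : ℂ ≃+* ℂ)] : Submodule ℚ (V k)) /
          Module.finrank ℚ ((π k).IntertwiningMap (π k))) =
      Module.finrank ℚ (antiSpan (ℂ ≃+* ℂ) (sigmaType fun j : {j // j ∈ T} => (Φ j.1).1)) +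
        Module.finrank ℚ (antiSpan (ℂ ≃+* ℂ) (sigmaType fun j : {j // j ∉ T} => (Φ j.1).1)) :=
    (IrrOdd.finrank_antiSpan_sigmaType_add_sum_eq (E := fun i => K i →+* ℂ) (fun i => (Φ i).1) π hirr hne
      hcov (· ∈ T)).2
  rw [e0, e1, e2]
  omega

/-- **ONE non-zero intersection `Ev_T(π) ∩ Ev_{Tᶜ}(π) ≠ 0` makes the family DEGENERATE** (`rank(Φ) ≤ Σ_i [K_i:ℚ]/2`,
i.e. `dim Hg(∏_I A_i) < Σ_i dim A_i`). [cite: Gordon1999HodgeAVSurvey, 7.5–7.7] [cite: MoonenZarhin1999LowDim, §3 (3.1)] -/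
theorem not_isNondegenerateFamily_of_inf_ne_bot (Φ : ∀ i, CMType (K i))
    (π : ∀ k, Representation ℚ (ℂ ≃+* ℂ) (V k))
    (hirr : ∀ k, (π k).IsIrreducible) (hne : ∀ k l, k ≠ l → ∀ S : (π k).IntertwiningMap (π l), S = 0)
    (hcov : ∀ (i : I) (P : Submodule ℚ ((K i →+* ℂ) → ℚ)), P ≤ antiSpan (ℂ ≃+* ℂ) (Φ i).1 → P ≠ ⊥ →
      (∀ (g : ℂ ≃+* ℂ) (a : (K i →+* ℂ) → ℚ), a ∈ P → (fun s => a (g • s)) ∈ P) →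
      ∃ k, ∃ T : ((K i →+* ℂ) → ℚ) →ₗ[ℚ] V k,
        (∀ (g : ℂ ≃+* ℂ) (a : (K i →+* ℂ) → ℚ), T (fun s => a (g⁻¹ • s)) = π k g (T a)) ∧ ∃ a ∈ P, T a ≠ 0)
    (T : Finset I) {k₀ : κ}
    (hk₀ : ((⨆ j : {j // j ∈ T}, Ev[ℂ ≃+* ℂ, π k₀, antiVec (Φ j.1).1 (1 : ℂ ≃+* ℂ)]) ⊓
        ⨆ j : {j // j ∉ T}, Ev[ℂ ≃+* ℂ, π k₀, antiVec (Φ j.1).1 (1 : ℂ ≃+* ℂ)] : Submodule ℚ (V k₀)) ≠ ⊥) :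
    ¬ CMAlgebra.IsNondegenerateFamily Φ := by
  classical
  intro hnd
  -- the family is non-empty (a slot of `T` carries the non-zero intersection)
  have hI : Nonempty I := by
    by_contra hI
    rw [not_nonempty_iff] at hI
    apply hk₀
    haveI : IsEmpty {j // j ∈ T} := Subtype.isEmpty_of_false fun j _ => hI.false j
    rw [iSup_of_empty, bot_inf_eq]
  obtain ⟨i₀⟩ := hI
  obtain ⟨s₀⟩ : Nonempty (K i₀ →+* ℂ) := inferInstance
  haveI : Nonempty (Σ i, (K i →+* ℂ)) := ⟨⟨i₀, s₀⟩⟩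
  obtain ⟨hdvd, hsum⟩ := IrrOdd.finrank_antiSpan_sigmaType_add_sum_eq (E := fun i => K i →+* ℂ)
    (fun i => (Φ i).1) π hirr hne hcov (· ∈ T)
  -- uniform spelling of the three spans
  have hsum' : Module.finrank ℚ (antiSpan (ℂ ≃+* ℂ) (sigmaType fun i => (Φ i).1)) + ∑ k, Module.finrank ℚ (V k) *
        (Module.finrank ℚ ((⨆ j : {j // j ∈ T}, Ev[ℂ ≃+* ℂ, π k, antiVec (Φ j.1).1 (1 : ℂ ≃+* ℂ)]) ⊓
            ⨆ j : {j // j ∉ T}, Ev[ℂ ≃+* ℂ, π k, antiVec (Φ j.1).1 (1 : ℂ ≃+* ℂ)] : Submodule ℚ (V k)) /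
          Module.finrank ℚ ((π k).IntertwiningMap (π k))) =
      Module.finrank ℚ (antiSpan (ℂ ≃+* ℂ) (sigmaType fun j : {j // j ∈ T} => (Φ j.1).1)) +
        Module.finrank ℚ (antiSpan (ℂ ≃+* ℂ) (sigmaType fun j : {j // j ∉ T} => (Φ j.1).1)) := hsum
  -- the `k₀` term of the defect is at least `d_{k₀} ≥ 1`
  have hpos : 0 < Module.finrank ℚ ((⨆ j : {j // j ∈ T}, Ev[ℂ ≃+* ℂ, π k₀, antiVec (Φ j.1).1 (1 : ℂ ≃+* ℂ)]) ⊓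
      ⨆ j : {j // j ∉ T}, Ev[ℂ ≃+* ℂ, π k₀, antiVec (Φ j.1).1 (1 : ℂ ≃+* ℂ)] : Submodule ℚ (V k₀)) := by
    rw [Module.finrank_pos_iff]
    exact (Submodule.nontrivial_iff_ne_bot).2 hk₀
  have hδ := IrrOdd.finrank_intertwiningMap_pos (π k₀) (hirr k₀)
  have hterm : 1 ≤ Module.finrank ℚ (V k₀) *
      (Module.finrank ℚ ((⨆ j : {j // j ∈ T}, Ev[ℂ ≃+* ℂ, π k₀, antiVec (Φ j.1).1 (1 : ℂ ≃+* ℂ)]) ⊓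
          ⨆ j : {j // j ∉ T}, Ev[ℂ ≃+* ℂ, π k₀, antiVec (Φ j.1).1 (1 : ℂ ≃+* ℂ)] : Submodule ℚ (V k₀)) /
        Module.finrank ℚ ((π k₀).IntertwiningMap (π k₀))) :=
    Nat.mul_pos (IrrOdd.finrank_pos_of_isIrreducible (π k₀) (hirr k₀))
      ((Nat.one_le_div_iff hδ).2 (Nat.le_of_dvd hpos (hdvd k₀)))
  have hle : Module.finrank ℚ (V k₀) *
      (Module.finrank ℚ ((⨆ j : {j // j ∈ T}, Ev[ℂ ≃+* ℂ, π k₀, antiVec (Φ j.1).1 (1 : ℂ ≃+* ℂ)]) ⊓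
          ⨆ j : {j // j ∉ T}, Ev[ℂ ≃+* ℂ, π k₀, antiVec (Φ j.1).1 (1 : ℂ ≃+* ℂ)] : Submodule ℚ (V k₀)) /
        Module.finrank ℚ ((π k₀).IntertwiningMap (π k₀))) ≤
      ∑ k, Module.finrank ℚ (V k) *
        (Module.finrank ℚ ((⨆ j : {j // j ∈ T}, Ev[ℂ ≃+* ℂ, π k, antiVec (Φ j.1).1 (1 : ℂ ≃+* ℂ)]) ⊓
            ⨆ j : {j // j ∉ T}, Ev[ℂ ≃+* ℂ, π k, antiVec (Φ j.1).1 (1 : ℂ ≃+* ℂ)] : Submodule ℚ (V k)) /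
          Module.finrank ℚ ((π k).IntertwiningMap (π k))) :=
    Finset.single_le_sum (f := fun k => Module.finrank ℚ (V k) *
      (Module.finrank ℚ ((⨆ j : {j // j ∈ T}, Ev[ℂ ≃+* ℂ, π k, antiVec (Φ j.1).1 (1 : ℂ ≃+* ℂ)]) ⊓
          ⨆ j : {j // j ∉ T}, Ev[ℂ ≃+* ℂ, π k, antiVec (Φ j.1).1 (1 : ℂ ≃+* ℂ)] : Submodule ℚ (V k)) /
        Module.finrank ℚ ((π k).IntertwiningMap (π k)))) (fun k _ => Nat.zero_le _) (Finset.mem_univ k₀)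
  -- each block is bounded by the sum of its members' `[K_j:ℚ]/2`
  have hmem : ∀ i, Module.finrank ℚ (antiSpan (ℂ ≃+* ℂ) (Φ i).1) ≤ Module.finrank ℚ (K i) / 2 := fun i => by
    haveI : Nonempty (K i →+* ℂ) := inferInstance
    have h1 := (isCMTypeWith_conj (Φ i)).typeRank_le
    rw [(isCMTypeWith_conj (Φ i)).typeRank_eq_finrank_antiSpan_add_one, Embeddings.card] at h1
    have h2 : Module.finrank ℚ (antiSpan (ℂ ≃+* ℂ) (Φ i).1) + 1 ≤ Module.finrank ℚ (K i) / 2 + 1 := h1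
    omega
  have hA : Module.finrank ℚ (antiSpan (ℂ ≃+* ℂ) (sigmaType fun j : {j // j ∈ T} => (Φ j.1).1)) ≤
      ∑ j : {j // j ∈ T}, Module.finrank ℚ (K j.1) / 2 :=
    (finrank_antiSpan_sigmaType_le (G := ℂ ≃+* ℂ) (E := fun j : {j // j ∈ T} => K j.1 →+* ℂ)
      fun j => (Φ j.1).1).trans (Finset.sum_le_sum fun j _ => hmem j.1)
  have hB : Module.finrank ℚ (antiSpan (ℂ ≃+* ℂ) (sigmaType fun j : {j // j ∉ T} => (Φ j.1).1)) ≤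
      ∑ j : {j // j ∉ T}, Module.finrank ℚ (K j.1) / 2 :=
    (finrank_antiSpan_sigmaType_le (G := ℂ ≃+* ℂ) (E := fun j : {j // j ∉ T} => K j.1 →+* ℂ)
      fun j => (Φ j.1).1).trans (Finset.sum_le_sum fun j _ => hmem j.1)
  have hs1 : ∑ i ∈ T, Module.finrank ℚ (K i) / 2 = ∑ j : {j // j ∈ T}, Module.finrank ℚ (K j.1) / 2 :=
    Finset.sum_subtype T (fun _ => Iff.rfl) fun i => Module.finrank ℚ (K i) / 2
  have hs2 : ∑ i ∈ Tᶜ, Module.finrank ℚ (K i) / 2 = ∑ j : {j // j ∉ T}, Module.finrank ℚ (K j.1) / 2 :=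
    Finset.sum_subtype Tᶜ (fun i => Finset.mem_compl) fun i => Module.finrank ℚ (K i) / 2
  have hs3 := Finset.sum_add_sum_compl T fun i => Module.finrank ℚ (K i) / 2
  -- `Σ_i [K_i:ℚ]/2 = (Σ_i [K_i:ℚ])/2` (all degrees are even)
  have hN : (∑ i, Module.finrank ℚ (K i)) / 2 = ∑ i, Module.finrank ℚ (K i) / 2 := by
    have h := card_sigma_div_two (G := ℂ ≃+* ℂ) (E := fun i => K i →+* ℂ) fun i => isCMTypeWith_conj (Φ i)
    rw [Fintype.card_sigma] at h
    simp only [Embeddings.card] at h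
    exact h
  have hrank : CMAlgebra.cmFamilyRank Φ = Module.finrank ℚ (antiSpan (ℂ ≃+* ℂ) (sigmaType fun i => (Φ i).1)) + 1 :=
    (IsCMTypeWith.sigmaType fun i => isCMTypeWith_conj (Φ i)).typeRank_eq_finrank_antiSpan_add_one
  rw [CMAlgebra.isNondegenerateFamily_iff, hrank, hN] at hnd
  omega

variable {Φ : ∀ i, CMType (K i)} {A : I → AbelianVariety ℂ} {ι : ∀ i, 𝓞 (K i) →+* End (A i)}
  {θ : ∀ i, K i →+* Module.End ℂ (complexBetti (A i).X 1)}

/-- **… and SIMPLE, PAIRWISE NON-ISOGENOUS realisations then carry an EXCEPTIONAL Hodge class on some product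
`⨁_{j<N} A_{π j}`** (a rational `(m,m)` class outside `Dᵐ`): one irreducible `π` whose block evaluation spaces
`Ev_T(π)`, `Ev_{Tᶜ}(π)` meet non-trivially suffices. [cite: Gordon1999HodgeAVSurvey, 7.5–7.7] [cite: MoonenZarhin1999LowDim, §3 (3.1)] -/
theorem exists_exceptional_prod_of_inf_ne_bot [Nonempty I] (π : ∀ k, Representation ℚ (ℂ ≃+* ℂ) (V k))
    (hirr : ∀ k, (π k).IsIrreducible) (hne : ∀ k l, k ≠ l → ∀ S : (π k).IntertwiningMap (π l), S = 0)
    (hcov : ∀ (i : I) (P : Submodule ℚ ((K i →+* ℂ) → ℚ)), P ≤ antiSpan (ℂ ≃+* ℂ) (Φ i).1 → P ≠ ⊥ →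
      (∀ (g : ℂ ≃+* ℂ) (a : (K i →+* ℂ) → ℚ), a ∈ P → (fun s => a (g • s)) ∈ P) →
      ∃ k, ∃ T : ((K i →+* ℂ) → ℚ) →ₗ[ℚ] V k,
        (∀ (g : ℂ ≃+* ℂ) (a : (K i →+* ℂ) → ℚ), T (fun s => a (g⁻¹ • s)) = π k g (T a)) ∧ ∃ a ∈ P, T a ≠ 0)
    (T : Finset I) {k₀ : κ}
    (hk₀ : ((⨆ j : {j // j ∈ T}, Ev[ℂ ≃+* ℂ, π k₀, antiVec (Φ j.1).1 (1 : ℂ ≃+* ℂ)]) ⊓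
        ⨆ j : {j // j ∉ T}, Ev[ℂ ≃+* ℂ, π k₀, antiVec (Φ j.1).1 (1 : ℂ ≃+* ℂ)] : Submodule ℚ (V k₀)) ≠ ⊥)
    (hA : ∀ i, IsCMTypeRealisation (Φ i) (A i) (ι i) (θ i)) (hs : ∀ i, (A i).IsSimple)
    (hniso : ∀ i j, i ≠ j → ¬ AbelianVariety.IsIsogenous (A i) (A j)) :
    ∃ (N : ℕ) (ϖ : Fin N → I) (m : ℕ) (c : complexBetti (⨁ fun j : Fin N => A (ϖ j)).X (2 * m)),
      IsRationalClass c ∧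
      IsOfHodgeType (⨁ fun j : Fin N => A (ϖ j)).dim (⨁ fun j : Fin N => A (ϖ j)).X (2 * m) m m c ∧
      c ∉ divisorClassesSpan (⨁ fun j : Fin N => A (ϖ j)).X (⨁ fun j : Fin N => A (ϖ j)).dim m :=
  CMAlgebra.exists_exceptional_prod_of_not_isNondegenerateFamily
    (CMAlgebra.isSeparatingFamily_of_isSimple_of_pairwise_not_isIsogenous hA hs hniso)
    (not_isNondegenerateFamily_of_inf_ne_bot Φ π hirr hne hcov T hk₀) hA

end Summit.HodgeConjecture.CorCM

end
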